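import Summits.NavierStokesRegularity.NavierStokesRegularity.Theorems.ExtremiserTransienceNearExtremalTransienceExtremiserLiouvilleNoGainFromConstants
import HarnessLib

/-!
# Crux `ExtremiserTransience.NearExtremalTransience` (stmt-NavierStokesRegularity-21883), line `extremiser_liouville`,
# stub K1b `stub_noAnalyticExtremal` — REDUCTION OF THE STUB TO ITS RESIDUE via `noGainFromConstants`

`--supports stmt-NavierStokesRegularity-21883` (helper).  Author: prover seat `ns-el-k1b` (g0).

With «no gain from constants» PROVED (`ExtremiserLiouville.noGainFromConstants`), the registered stub K1b decomposes as follows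
(every arrow kernel-checked here; the two leaves are NOT proved):
* `extendedSharp_of_density` — the sharp inequality `|S(w)| ≤ κ⋆·M·‖ω‖₂‖∇ω‖₂` on the stub's EXTENDED class (admissible minus
  `L²`) follows from a DENSITY leaf (every such `w` is approximated by `u ∈ C^∞_c` divergence free plus a constant `b` with
  `‖u + b‖ ≤ M + ε` and `S, Z, P` within `ε`) and `noGainFromConstants` (`ε → 0`);
* `stub_noAnalyticExtremal_of_extendedSharp_of_eqCase` — given the extended sharp inequality, the stub (with `≤`) is
  equivalent to its EQUALITY case (an analytic extended EXTREMISER does not exist);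
* `ext_le_bound_of_shift` — structural fact about that residue: an extended extremiser is CHEBYSHEV-CENTRED, `‖w + b‖_∞ ≥ M`
  for every constant `b` (`ρ = 1` exactly — the theoretical value of the ratio the line card's instrument I1 measured).
The companion file `…NoAnalyticExtremalFarFieldGap` shows the equality case is impossible when `‖w‖ ≤ M' < M` off a ball, so
the residue of K1b is: DENSITY (support-sized, known mechanism) + the «PLATEAU AT INFINITY» extremisers (crux-sized).

WHAT THIS IS NOT: not K1b; K1b is a STATIC statement about analytic κ⋆-efficient fields; the crux NET, rung N0 and NS regularity stay OPEN — nothing here proves NS regularity. [folklore]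
-/

noncomputable section

open Set Filter Topology MeasureTheory Metric
open scoped InnerProductSpace RealInnerProductSpace ENNReal NNReal ContDiff
open Literature.Analysis.FluidPDE

namespace Summit.NavierStokesRegularity.NavierStokesRegularity.Theorems

-- the problem directory repeats the summit name (`NavierStokesRegularity/NavierStokesRegularity`)
set_option linter.dupNamespace false

namespace ExtremiserLiouville

open DepletionLadder.KStar.HalfSpace (E3)

/-! ## Reduction of the registered stub K1b to its residue -/

/-- **K1b ⟸ (extended sharp inequality) ∧ (K1b with EQUALITY).**  If the sharp depletion inequality
`|S(w)| ≤ κ⋆ M ‖ω‖₂ ‖∇ω‖₂` holds on the stub's EXTENDED class (admissible minus `L²`: `C^∞`, divergence free, `‖w‖ ≤ M`,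
bounded gradient, `D¹w, D²w ∈ L²`), then a violator of the registered stub is an exact extended extremiser, so the stub
follows from its equality case.  Both hypotheses are NOT proved here (the first follows from a density lemma and
`noGainFromConstants`, see `extendedSharp_of_density`; the second is the crux-sized residue of K1b, incl. the «plateau at
infinity» case).  The conclusion is the registered stub VERBATIM. [folklore] -/
theorem stub_noAnalyticExtremal_of_extendedSharp_of_eqCase
    (hext : ∀ (w : EuclideanSpace ℝ (Fin 3) → EuclideanSpace ℝ (Fin 3)) (M B : ℝ), ContDiff ℝ (⊤ : ℕ∞) w → Literature.Analysis.FluidPDE.VectorCalculus.IsDivFree w → (∀ x, ‖w x‖ ≤ M) → (∀ x, ‖fderiv ℝ w x‖ ≤ B) → (∫⁻ x, ‖iteratedFDeriv ℝ 1 w x‖ₑ ^ 2 < ⊤) → (∫⁻ x, ‖iteratedFDeriv ℝ 2 w x‖ₑ ^ 2 < ⊤) → |∫ x, ⟪Literature.Analysis.FluidPDE.curl w x, fderiv ℝ w x (Literature.Analysis.FluidPDE.curl w x)⟫_ℝ| ≤ (sInf {κ : ℝ | (∀ (v : EuclideanSpace ℝ (Fin 3) → EuclideanSpace ℝ (Fin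 3)) (M B : ℝ), ContDiff ℝ (⊤ : ℕ∞) v → Literature.Analysis.FluidPDE.VectorCalculus.IsDivFree v → (∀ x, ‖v x‖ ≤ M) → (∀ x, ‖fderiv ℝ v x‖ ≤ B) → (∫⁻ x, ‖iteratedFDeriv ℝ 0 v x‖ₑ ^ 2 < ⊤) → (∫⁻ x, ‖iteratedFDeriv ℝ 1 v x‖ₑ ^ 2 < ⊤) → (∫⁻ x, ‖iteratedFDeriv ℝ 2 v x‖ₑ ^ 2 < ⊤) → |∫ x, ⟪Literature.Analysis.FluidPDE.curl v x, fderiv ℝ v x (Literature.Analysis.FluidPDE.curl v x)⟫_ℝ| ≤ κ * M * Real.sqrt (∫ x, ‖Literature.Analysis.FluidPDE.curl v x‖ ^ 2) * Real.sqrt (∫ x, Literature.Analysis.FluidPDE.frobeniusNormSq (fderiv ℝ (Literature.Analysis.FluidPDE.curl v) x)))}) * M * Real.sqrt (∫ x, ‖Literature.Analysis.FluidPDE.curl w x‖ ^ 2) * Real.sqrt (∫ x, Literature.Analysis.FluidPDE.frobeniusNormSq (fderiv ℝ (Literature.Analysis.FluidPDE.curl w) x)))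
    (heq : ¬ ∃ (w : EuclideanSpace ℝ (Fin 3) → EuclideanSpace ℝ (Fin 3)), AnalyticOnNhd ℝ w Set.univ ∧ (ContDiff ℝ (⊤ : ℕ∞) w ∧ Literature.Analysis.FluidPDE.VectorCalculus.IsDivFree w ∧ (∃ B : ℝ, ∀ x, ‖fderiv ℝ w x‖ ≤ B) ∧ (∫⁻ x, ‖iteratedFDeriv ℝ 1 w x‖ₑ ^ 2 < ⊤) ∧ (∫⁻ x, ‖iteratedFDeriv ℝ 2 w x‖ₑ ^ 2 < ⊤) ∧ ∃ M : ℝ, (∀ x, ‖w x‖ ≤ M) ∧ 0 < M * Real.sqrt (∫ x, ‖Literature.Analysis.FluidPDE.curl w x‖ ^ 2) * Real.sqrt (∫ x, Literature.Analysis.FluidPDE.frobeniusNormSq (fderiv ℝ (Literature.Analysis.FluidPDE.curl w) x)) ∧ (sInf {κ : ℝ | (∀ (v : EuclideanSpace ℝ (Fin 3) → EuclideanSpace ℝ (Fin 3)) (M B : ℝ), ContDiff ℝ (⊤ : ℕ∞) v → Literature.Analysis.FluidPDE.VectorCalculus.IsDivFree v → (∀ x, ‖v x‖ ≤ M) → (∀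 x, ‖fderiv ℝ v x‖ ≤ B) → (∫⁻ x, ‖iteratedFDeriv ℝ 0 v x‖ₑ ^ 2 < ⊤) → (∫⁻ x, ‖iteratedFDeriv ℝ 1 v x‖ₑ ^ 2 < ⊤) → (∫⁻ x, ‖iteratedFDeriv ℝ 2 v x‖ₑ ^ 2 < ⊤) → |∫ x, ⟪Literature.Analysis.FluidPDE.curl v x, fderiv ℝ v x (Literature.Analysis.FluidPDE.curl v x)⟫_ℝ| ≤ κ * M * Real.sqrt (∫ x, ‖Literature.Analysis.FluidPDE.curl v x‖ ^ 2) * Real.sqrt (∫ x, Literature.Analysis.FluidPDE.frobeniusNormSq (fderiv ℝ (Literature.Analysis.FluidPDE.curl v) x)))}) * M * Real.sqrt (∫ x, ‖Literature.Analysis.FluidPDE.curl w x‖ ^ 2) * Real.sqrt (∫ x, Literature.Analysis.FluidPDE.frobeniusNormSq (fderiv ℝ (Literature.Analysis.FluidPDE.curl w) x)) = |∫ x, ⟪Literature.Analysis.FluidPDE.curl w x, fderiv ℝ w x (Literature.Analysis.FluidPDE.curl w x)⟫_ℝ|)) :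
    ¬ ∃ (w : EuclideanSpace ℝ (Fin 3) → EuclideanSpace ℝ (Fin 3)), AnalyticOnNhd ℝ w Set.univ ∧ (ContDiff ℝ (⊤ : ℕ∞) w ∧ Literature.Analysis.FluidPDE.VectorCalculus.IsDivFree w ∧ (∃ B : ℝ, ∀ x, ‖fderiv ℝ w x‖ ≤ B) ∧ (∫⁻ x, ‖iteratedFDeriv ℝ 1 w x‖ₑ ^ 2 < ⊤) ∧ (∫⁻ x, ‖iteratedFDeriv ℝ 2 w x‖ₑ ^ 2 < ⊤) ∧ ∃ M : ℝ, (∀ x, ‖w x‖ ≤ M) ∧ 0 < M * Real.sqrt (∫ x, ‖Literature.Analysis.FluidPDE.curl w x‖ ^ 2) * Real.sqrt (∫ x, Literature.Analysis.FluidPDE.frobeniusNormSq (fderiv ℝ (Literature.Analysis.FluidPDE.curl w) x)) ∧ (sInf {κ : ℝ | (∀ (v : EuclideanSpace ℝ (Fin 3) → EuclideanSpace ℝ (Fin 3)) (M B : ℝ), ContDiff ℝ (⊤ : ℕ∞) v → Literature.Analysis.FluidPDE.VectorCalculus.IsDivFree v → (∀ x, ‖v x‖ ≤ M) → (∀ x,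 ‖fderiv ℝ v x‖ ≤ B) → (∫⁻ x, ‖iteratedFDeriv ℝ 0 v x‖ₑ ^ 2 < ⊤) → (∫⁻ x, ‖iteratedFDeriv ℝ 1 v x‖ₑ ^ 2 < ⊤) → (∫⁻ x, ‖iteratedFDeriv ℝ 2 v x‖ₑ ^ 2 < ⊤) → |∫ x, ⟪Literature.Analysis.FluidPDE.curl v x, fderiv ℝ v x (Literature.Analysis.FluidPDE.curl v x)⟫_ℝ| ≤ κ * M * Real.sqrt (∫ x, ‖Literature.Analysis.FluidPDE.curl v x‖ ^ 2) * Real.sqrt (∫ x, Literature.Analysis.FluidPDE.frobeniusNormSq (fderiv ℝ (Literature.Analysis.FluidPDE.curl v) x)))}) * M * Real.sqrt (∫ x, ‖Literature.Analysis.FluidPDE.curl w x‖ ^ 2) * Real.sqrt (∫ x, Literature.Analysis.FluidPDE.frobeniusNormSq (fderiv ℝ (Literature.Analysis.FluidPDE.curl w) x)) ≤ |∫ x, ⟪Literature.Analysis.FluidPDE.curl w x, fderiv ℝ w x (Literature.Analysis.FluidPDE.curl w x)⟫_ℝ|) := by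
  rintro ⟨w, han, hcd, hdiv, ⟨B, hB⟩, h1, h2, M, hM, hpos, hge⟩
  have hle := hext w M B hcd hdiv hM hB h1 h2
  exact heq ⟨w, han, hcd, hdiv, ⟨B, hB⟩, h1, h2, M, hM, hpos, le_antisymm hge hle⟩

/-- **The extended sharp inequality from a density lemma (via `noGainFromConstants`).**  If every field of the extended
class is approximated, for every `ε > 0`, by a `C^∞_c` divergence-free field `u` and a constant `b` with `‖u + b‖ ≤ M + ε` and
stretching / enstrophy / palinstrophy integrals within `ε` of those of `w`, then `|S(w)| ≤ κ⋆ M ‖ω‖₂ ‖∇ω‖₂` on the whole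
extended class (`noGainFromConstants` for `u, b, M + ε`, then `ε → 0`).  The density hypothesis is NOT proved here
(Bogovskiĭ-corrected cut-offs of the decaying tail `w − lim_∞ w`; support-sized, known mechanism). [folklore] -/
theorem extendedSharp_of_density
    (hdens : ∀ (w : EuclideanSpace ℝ (Fin 3) → EuclideanSpace ℝ (Fin 3)) (M B : ℝ), ContDiff ℝ (⊤ : ℕ∞) w → Literature.Analysis.FluidPDE.VectorCalculus.IsDivFree w → (∀ x, ‖w x‖ ≤ M) → (∀ x, ‖fderiv ℝ w x‖ ≤ B) → (∫⁻ x, ‖iteratedFDeriv ℝ 1 w x‖ₑ ^ 2 < ⊤) → (∫⁻ x, ‖iteratedFDeriv ℝ 2 w x‖ₑ ^ 2 < ⊤) → ∀ ε : ℝ, 0 < ε → ∃ (u : EuclideanSpace ℝ (Fin 3) → EuclideanSpace ℝ (Fin 3)) (b : EuclideanSpace ℝ (Fin 3)), ContDiff ℝ (⊤ : ℕ∞) u ∧ HasCompactSupport u ∧ Literature.Analysis.FluidPDE.VectorCalculus.IsDivFree u ∧ (∀ x, ‖u x + b‖ ≤ M + ε) ∧ |(∫ x, ⟪Literature.Analysis.FluidPDE.curl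 u x, fderiv ℝ u x (Literature.Analysis.FluidPDE.curl u x)⟫_ℝ) - ∫ x, ⟪Literature.Analysis.FluidPDE.curl w x, fderiv ℝ w x (Literature.Analysis.FluidPDE.curl w x)⟫_ℝ| ≤ ε ∧ |(∫ x, ‖Literature.Analysis.FluidPDE.curl u x‖ ^ 2) - ∫ x, ‖Literature.Analysis.FluidPDE.curl w x‖ ^ 2| ≤ ε ∧ |(∫ x, Literature.Analysis.FluidPDE.frobeniusNormSq (fderiv ℝ (Literature.Analysis.FluidPDE.curl u) x)) - ∫ x, Literature.Analysis.FluidPDE.frobeniusNormSq (fderiv ℝ (Literature.Analysis.FluidPDE.curl w) x)| ≤ ε) :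
    ∀ (w : EuclideanSpace ℝ (Fin 3) → EuclideanSpace ℝ (Fin 3)) (M B : ℝ), ContDiff ℝ (⊤ : ℕ∞) w → Literature.Analysis.FluidPDE.VectorCalculus.IsDivFree w → (∀ x, ‖w x‖ ≤ M) → (∀ x, ‖fderiv ℝ w x‖ ≤ B) → (∫⁻ x, ‖iteratedFDeriv ℝ 1 w x‖ₑ ^ 2 < ⊤) → (∫⁻ x, ‖iteratedFDeriv ℝ 2 w x‖ₑ ^ 2 < ⊤) → |∫ x, ⟪Literature.Analysis.FluidPDE.curl w x, fderiv ℝ w x (Literature.Analysis.FluidPDE.curl w x)⟫_ℝ| ≤ (sInf {κ : ℝ | (∀ (v : EuclideanSpace ℝ (Fin 3) → EuclideanSpace ℝ (Fin 3)) (M B : ℝ), ContDiff ℝ (⊤ : ℕ∞) v → Literature.Analysis.FluidPDE.VectorCalculus.IsDivFree v → (∀ x, ‖v x‖ ≤ M) → (∀ x, ‖fderiv ℝ v x‖ ≤ B) → (∫⁻ x, ‖iteratedFDeriv ℝ 0 v x‖ₑ ^ 2 < ⊤) → (∫⁻ x, ‖iteratedFDeriv ℝ 1 v x‖ₑ ^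 2 < ⊤) → (∫⁻ x, ‖iteratedFDeriv ℝ 2 v x‖ₑ ^ 2 < ⊤) → |∫ x, ⟪Literature.Analysis.FluidPDE.curl v x, fderiv ℝ v x (Literature.Analysis.FluidPDE.curl v x)⟫_ℝ| ≤ κ * M * Real.sqrt (∫ x, ‖Literature.Analysis.FluidPDE.curl v x‖ ^ 2) * Real.sqrt (∫ x, Literature.Analysis.FluidPDE.frobeniusNormSq (fderiv ℝ (Literature.Analysis.FluidPDE.curl v) x)))}) * M * Real.sqrt (∫ x, ‖Literature.Analysis.FluidPDE.curl w x‖ ^ 2) * Real.sqrt (∫ x, Literature.Analysis.FluidPDE.frobeniusNormSq (fderiv ℝ (Literature.Analysis.FluidPDE.curl w) x)) := by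
  intro w M B hcd hdiv hM hB h1 h2
  set κ : ℝ := sInf {κ : ℝ | (∀ (v : EuclideanSpace ℝ (Fin 3) → EuclideanSpace ℝ (Fin 3)) (M B : ℝ), ContDiff ℝ (⊤ : ℕ∞) v → Literature.Analysis.FluidPDE.VectorCalculus.IsDivFree v → (∀ x, ‖v x‖ ≤ M) → (∀ x, ‖fderiv ℝ v x‖ ≤ B) → (∫⁻ x, ‖iteratedFDeriv ℝ 0 v x‖ₑ ^ 2 < ⊤) → (∫⁻ x, ‖iteratedFDeriv ℝ 1 v x‖ₑ ^ 2 < ⊤) → (∫⁻ x, ‖iteratedFDeriv ℝ 2 v x‖ₑ ^ 2 < ⊤) → |∫ x, ⟪Literature.Analysis.FluidPDE.curl v x, fderiv ℝ v x (Literature.Analysis.FluidPDE.curl v x)⟫_ℝ| ≤ κ * M * Real.sqrt (∫ x, ‖Literature.Analysis.FluidPDE.curl v x‖ ^ 2) * Real.sqrt (∫ x, Literature.Analysis.FluidPDE.frobeniusNormSq (fderiv ℝ (Literature.Analysis.FluidPDE.curl v) x)))} with hκdef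
  have hκ0 : 0 ≤ κ := le_trans (by norm_num) DepletionLadder.sharpDepletion_gt.le
  have hM0 : 0 ≤ M := (norm_nonneg _).trans (hM 0)
  set S := ∫ x, ⟪curl w x, fderiv ℝ w x (curl w x)⟫ with hSdef
  set Z := ∫ x, ‖curl w x‖ ^ 2 with hZdef
  set P := ∫ x, frobeniusNormSq (fderiv ℝ (curl w) x) with hPdef
  have hZ : 0 ≤ Z := integral_nonneg fun x => sq_nonneg _
  have hP : 0 ≤ P := integral_nonneg fun x => frobeniusNormSq_nonneg _
  -- the bound for every ε > 0
  set g : ℝ → ℝ := fun ε => κ * (M + ε) * Real.sqrt (Z + ε) * Real.sqrt (P + ε) + ε with hgdef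
  have hbound : ∀ ε : ℝ, 0 < ε → |S| ≤ g ε := by
    intro ε hε
    obtain ⟨u, b, hu, huc, hudiv, huM, hS, hZ', hP'⟩ := hdens w M B hcd hdiv hM hB h1 h2 ε hε
    have hng := noGainFromConstants hu huc hudiv b huM
    have h1' : Real.sqrt (∫ x, ‖curl u x‖ ^ 2) ≤ Real.sqrt (Z + ε) :=
      Real.sqrt_le_sqrt (by linarith [(abs_le.1 hZ').2])
    have h2' : Real.sqrt (∫ x, frobeniusNormSq (fderiv ℝ (curl u) x)) ≤ Real.sqrt (P + ε) :=
      Real.sqrt_le_sqrt (by linarith [(abs_le.1 hP').2])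
    have hMε : 0 ≤ κ * (M + ε) := mul_nonneg hκ0 (by linarith)
    have h3 : κ * (M + ε) * Real.sqrt (∫ x, ‖curl u x‖ ^ 2) * Real.sqrt (∫ x, frobeniusNormSq (fderiv ℝ (curl u) x)) ≤
        κ * (M + ε) * Real.sqrt (Z + ε) * Real.sqrt (P + ε) :=
      mul_le_mul (mul_le_mul_of_nonneg_left h1' hMε) h2' (Real.sqrt_nonneg _) (mul_nonneg hMε (Real.sqrt_nonneg _))
    have h5 := abs_sub_abs_le_abs_sub (∫ x, ⟪curl u x, fderiv ℝ u x (curl u x)⟫) S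
    have h4 : |S| ≤ |∫ x, ⟪curl u x, fderiv ℝ u x (curl u x)⟫| + ε := by
      have h6 := abs_sub_abs_le_abs_sub S (∫ x, ⟪curl u x, fderiv ℝ u x (curl u x)⟫)
      rw [abs_sub_comm] at h6
      linarith
    show |S| ≤ κ * (M + ε) * Real.sqrt (Z + ε) * Real.sqrt (P + ε) + ε
    linarith
  -- continuity of g at 0
  have hg : ContinuousAt g 0 := by
    refine ContinuousAt.add ?_ continuousAt_id
    refine ContinuousAt.mul (ContinuousAt.mul ?_ ?_) ?_
    · exact continuousAt_const.mul (continuousAt_const.add continuousAt_id)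
    · exact Real.continuous_sqrt.continuousAt.comp (continuousAt_const.add continuousAt_id)
    · exact Real.continuous_sqrt.continuousAt.comp (continuousAt_const.add continuousAt_id)
  have hg0 : g 0 = κ * M * Real.sqrt Z * Real.sqrt P := by simp [hgdef]
  have hlim : Filter.Tendsto g (𝓝[>] 0) (𝓝 (g 0)) := hg.tendsto.mono_left nhdsWithin_le_nhds
  have hev : ∀ᶠ ε in 𝓝[>] (0:ℝ), |S| ≤ g ε := by
    filter_upwards [self_mem_nhdsWithin] with ε hε using hbound ε hε
  have := ge_of_tendsto hlim hev
  rw [hg0] at this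
  exact this

/-! ## Extended extremisers are Chebyshev-centred (the exact counterpart of instrument I1's `ρ = 1`) -/

/-- Adding a constant does not change `curl`, `D`, `D curl`. [folklore] -/
theorem derivs_add_const (w : EuclideanSpace ℝ (Fin 3) → EuclideanSpace ℝ (Fin 3)) (b : EuclideanSpace ℝ (Fin 3)) :
    (fderiv ℝ (fun x => w x + b) = fderiv ℝ w) ∧ (curl (fun x => w x + b) = curl w) := by
  have h1 : fderiv ℝ (fun x => w x + b) = fderiv ℝ w := by funext x; rw [fderiv_add_const]
  refine ⟨h1, ?_⟩
  funext x; rw [curl_eq_curlCLM, curl_eq_curlCLM, h1]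

/-- **An extended extremiser cannot lower its sup norm by a constant shift** (`ρ = 1` exactly): if `w` in the extended class
attains `|S(w)| = κ⋆·M·‖ω‖₂‖∇ω‖₂` with `M‖ω‖₂‖∇ω‖₂ > 0` and the extended sharp inequality `hext` holds, then every bound
`M''` of `‖w + b‖` satisfies `M ≤ M''`, for every constant `b` (constants are free in the extended class: `w + b` is again in
it with the same `curl`, `D`, `D²`).  This is the theoretical value of the Chebyshev ratio measured by the line card's
instrument I1 (kit j301175/j301210: `ρ ∈ [0.988, 1.000]` at band-limited optima). [folklore] -/
theorem ext_le_bound_of_shift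
    (hext : ∀ (w : EuclideanSpace ℝ (Fin 3) → EuclideanSpace ℝ (Fin 3)) (M B : ℝ), ContDiff ℝ (⊤ : ℕ∞) w → Literature.Analysis.FluidPDE.VectorCalculus.IsDivFree w → (∀ x, ‖w x‖ ≤ M) → (∀ x, ‖fderiv ℝ w x‖ ≤ B) → (∫⁻ x, ‖iteratedFDeriv ℝ 1 w x‖ₑ ^ 2 < ⊤) → (∫⁻ x, ‖iteratedFDeriv ℝ 2 w x‖ₑ ^ 2 < ⊤) → |∫ x, ⟪Literature.Analysis.FluidPDE.curl w x, fderiv ℝ w x (Literature.Analysis.FluidPDE.curl w x)⟫_ℝ| ≤ (sInf {κ : ℝ | (∀ (v : EuclideanSpace ℝ (Fin 3) → EuclideanSpace ℝ (Fin 3)) (M B : ℝ), ContDiff ℝ (⊤ : ℕ∞) v → Literature.Analysis.FluidPDE.VectorCalculus.IsDivFree v → (∀ x, ‖v x‖ ≤ M) → (∀ x, ‖fderiv ℝ v x‖ ≤ B) → (∫⁻ x, ‖iteratedFDeriv ℝ 0 v x‖ₑ ^ 2 < ⊤) → (∫⁻ x, ‖iteratedFDeriv ℝ 1 v x‖ₑ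 ^ 2 < ⊤) → (∫⁻ x, ‖iteratedFDeriv ℝ 2 v x‖ₑ ^ 2 < ⊤) → |∫ x, ⟪Literature.Analysis.FluidPDE.curl v x, fderiv ℝ v x (Literature.Analysis.FluidPDE.curl v x)⟫_ℝ| ≤ κ * M * Real.sqrt (∫ x, ‖Literature.Analysis.FluidPDE.curl v x‖ ^ 2) * Real.sqrt (∫ x, Literature.Analysis.FluidPDE.frobeniusNormSq (fderiv ℝ (Literature.Analysis.FluidPDE.curl v) x)))}) * M * Real.sqrt (∫ x, ‖Literature.Analysis.FluidPDE.curl w x‖ ^ 2) * Real.sqrt (∫ x, Literature.Analysis.FluidPDE.frobeniusNormSq (fderiv ℝ (Literature.Analysis.FluidPDE.curl w) x)))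
    {w : EuclideanSpace ℝ (Fin 3) → EuclideanSpace ℝ (Fin 3)} (hw : ContDiff ℝ ∞ w) (hdiv : VectorCalculus.IsDivFree w)
    {M B : ℝ} (hB : ∀ x, ‖fderiv ℝ w x‖ ≤ B)
    (h1 : ∫⁻ x, ‖iteratedFDeriv ℝ 1 w x‖ₑ ^ 2 < ⊤) (h2 : ∫⁻ x, ‖iteratedFDeriv ℝ 2 w x‖ₑ ^ 2 < ⊤)
    (hpos : 0 < M * Real.sqrt (∫ x, ‖curl w x‖ ^ 2) * Real.sqrt (∫ x, frobeniusNormSq (fderiv ℝ (curl w) x)))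
    (hatt : |∫ x, ⟪curl w x, fderiv ℝ w x (curl w x)⟫| = (sInf {κ : ℝ | (∀ (v : EuclideanSpace ℝ (Fin 3) → EuclideanSpace ℝ (Fin 3)) (M B : ℝ), ContDiff ℝ (⊤ : ℕ∞) v → Literature.Analysis.FluidPDE.VectorCalculus.IsDivFree v → (∀ x, ‖v x‖ ≤ M) → (∀ x, ‖fderiv ℝ v x‖ ≤ B) → (∫⁻ x, ‖iteratedFDeriv ℝ 0 v x‖ₑ ^ 2 < ⊤) → (∫⁻ x, ‖iteratedFDeriv ℝ 1 v x‖ₑ ^ 2 < ⊤) → (∫⁻ x, ‖iteratedFDeriv ℝ 2 v x‖ₑ ^ 2 < ⊤) → |∫ x, ⟪Literature.Analysis.FluidPDE.curl v x, fderiv ℝ v x (Literature.Analysis.FluidPDE.curl v x)⟫_ℝ| ≤ κ * M * Real.sqrt (∫ x, ‖Literature.Analysis.FluidPDE.curl v x‖ ^ 2) * Real.sqrt (∫ x, Literature.Analysis.FluidPDE.frobeniusNormSq (fderiv ℝ (Literature.Analysis.FluidPDE.curl v) x)))}) * M * Real.sqrt (∫ x, ‖curl w x‖ ^ 2) * Real.sqrt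 (∫ x, frobeniusNormSq (fderiv ℝ (curl w) x)))
    (b : EuclideanSpace ℝ (Fin 3)) {M'' : ℝ} (hM'' : ∀ x, ‖w x + b‖ ≤ M'') : M ≤ M'' := by
  set κ : ℝ := (sInf {κ : ℝ | (∀ (v : EuclideanSpace ℝ (Fin 3) → EuclideanSpace ℝ (Fin 3)) (M B : ℝ), ContDiff ℝ (⊤ : ℕ∞) v → Literature.Analysis.FluidPDE.VectorCalculus.IsDivFree v → (∀ x, ‖v x‖ ≤ M) → (∀ x, ‖fderiv ℝ v x‖ ≤ B) → (∫⁻ x, ‖iteratedFDeriv ℝ 0 v x‖ₑ ^ 2 < ⊤) → (∫⁻ x, ‖iteratedFDeriv ℝ 1 v x‖ₑ ^ 2 < ⊤) → (∫⁻ x, ‖iteratedFDeriv ℝ 2 v x‖ₑ ^ 2 < ⊤) → |∫ x, ⟪Literature.Analysis.FluidPDE.curl v x, fderiv ℝ v x (Literature.Analysis.FluidPDE.curl v x)⟫_ℝ| ≤ κ * M * Real.sqrt (∫ x, ‖Literature.Analysis.FluidPDE.curl v x‖ ^ 2) * Real.sqrt (∫ x, Literature.Analysis.FluidPDE.frobeniusNormSq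 (fderiv ℝ (Literature.Analysis.FluidPDE.curl v) x)))}) with hκdef
  have hκ : 0 < κ := lt_trans (by norm_num) DepletionLadder.sharpDepletion_gt
  obtain ⟨hD, hC⟩ := derivs_add_const w b
  have hcd : ContDiff ℝ ∞ (fun x => w x + b) := hw.add contDiff_const
  have hdv : VectorCalculus.IsDivFree (fun x => w x + b) := fun x => by
    unfold VectorCalculus.divergence; rw [hD]; exact hdiv x
  have hB' : ∀ x, ‖fderiv ℝ (fun x => w x + b) x‖ ≤ B := fun x => by rw [hD]; exact hB x
  have hk : ∀ k : ℕ, 1 ≤ k → iteratedFDeriv ℝ k (fun x => w x + b) = iteratedFDeriv ℝ k w := by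
    intro k hk
    have hw' : ContDiff ℝ k w := hw.of_le (by exact_mod_cast le_top)
    have hc' : ContDiff ℝ k (fun _ : EuclideanSpace ℝ (Fin 3) => b) := contDiff_const
    have h : (fun x => w x + b) = w + fun _ => b := rfl
    funext x
    rw [h, iteratedFDeriv_add_apply hw'.contDiffAt hc'.contDiffAt, iteratedFDeriv_const_of_ne (by omega),
      Pi.zero_apply, add_zero]
  have h1' : ∫⁻ x, ‖iteratedFDeriv ℝ 1 (fun x => w x + b) x‖ₑ ^ 2 < ⊤ := by rw [hk 1 le_rfl]; exact h1
  have h2' : ∫⁻ x, ‖iteratedFDeriv ℝ 2 (fun x => w x + b) x‖ₑ ^ 2 < ⊤ := by rw [hk 2 (by norm_num)]; exact h2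
  have hu := hext _ M'' B hcd hdv hM'' hB' h1' h2'
  rw [hC, hD] at hu
  -- `κ M √Z √P = |S| ≤ κ M'' √Z √P`
  rw [hatt] at hu
  have hM0 : 0 ≤ M := by
    by_contra h
    rw [not_le] at h
    have : M * Real.sqrt (∫ x, ‖curl w x‖ ^ 2) * Real.sqrt (∫ x, frobeniusNormSq (fderiv ℝ (curl w) x)) ≤ 0 := by
      have := Real.sqrt_nonneg (∫ x, ‖curl w x‖ ^ 2)
      have := Real.sqrt_nonneg (∫ x, frobeniusNormSq (fderiv ℝ (curl w) x))
      nlinarith [mul_nonneg (Real.sqrt_nonneg (∫ x, ‖curl w x‖ ^ 2)) (Real.sqrt_nonneg (∫ x, frobeniusNormSq (fderiv ℝ (curl w) x)))]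
    linarith
  have hZW : 0 < Real.sqrt (∫ x, ‖curl w x‖ ^ 2) * Real.sqrt (∫ x, frobeniusNormSq (fderiv ℝ (curl w) x)) := by
    rcases (mul_nonneg (Real.sqrt_nonneg (∫ x, ‖curl w x‖ ^ 2)) (Real.sqrt_nonneg (∫ x, frobeniusNormSq (fderiv ℝ (curl w) x)))).eq_or_lt with h | h
    · exfalso; rw [mul_assoc, ← h, mul_zero] at hpos; exact lt_irrefl _ hpos
    · exact h
  have key : κ * M * (Real.sqrt (∫ x, ‖curl w x‖ ^ 2) * Real.sqrt (∫ x, frobeniusNormSq (fderiv ℝ (curl w) x))) ≤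
      κ * M'' * (Real.sqrt (∫ x, ‖curl w x‖ ^ 2) * Real.sqrt (∫ x, frobeniusNormSq (fderiv ℝ (curl w) x))) := by
    simpa only [mul_assoc] using hu
  have := le_of_mul_le_mul_right key hZW
  exact le_of_mul_le_mul_left (by linarith) hκ

end ExtremiserLiouville

end Summit.NavierStokesRegularity.NavierStokesRegularity.Theorems

end
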